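import Summits.QuantumFields.YangMills.Theses.SmallFieldWidening

/-!
# Route `SmallFieldWidening`, crux r4 `PlainStabAdd` (stmt-QuantumFields-27718) — DEFINITIONS of LINE g6-B «additive unit-stability
# ladder», skeleton «local-split» (planner `ym-idea-1` g6): the level-`n` column map, the local plaquette neighbourhood, and the two
# registered stub statements `LocalSmallStep` (XL) ∕ `LocalNewLevelTail` (M)

This file carries, BYTE-IDENTICALLY, the four definitions of the registered skeleton `HOME/PlainStabAdd_localsplit.lean` of crux
`PlainStabAdd` (registered on stmt-QuantumFields-27718, 2026-08-28T11:58Z), so that the stubs can be proved and landed under `Theorems/`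
BY NAME and the skeleton's composition `PlainStabAdd_holds_of_stubs` can import them instead of re-declaring them:
* `colUp n x` — the level-`n` block (column top) containing a finest-level site (`blockOf` iterated `n` times);
* `nearCol F K r q` — the finest plaquettes of run `K` whose level-`K` column top lies within `ℓ¹` torus distance `r` of the run-`K`
  copy of the unit plaquette `q`;
* `LocalSmallStep` — STUB 1 (XL, the RG content): the one-sided one-step comparison of the threshold-multiplied unit-plaquette tail
  restricted to the local small-field event of the new finest level, with interval-summable slack;
* `LocalNewLevelTail` — STUB 2 (M): the Gibbs masses of the local new-level LARGE-field events are summable along the ladder with a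
  sub-Gaussian total, rate and power independent of the radius, uniformly in the family.
Nothing is proved here.  HONEST LABEL: rung R3 is a RECORD rung; no summit and nothing about the Yang–Mills mass gap is proved by this line.

References: T. Bałaban, CMP 102 (1985) 255–275 [Balaban1985UV3] ((7) p.257, (70)–(71) p.273, Lemma 3 p.269); CMP 109 (1987) 249–301
[Balaban1987RG1] ((0.1) p.252, Thm 1 p.259); CMP 122 (1989) 355–392 [Balaban1989LargeFieldII] (§1).
-/

noncomputable section

namespace Summit.QuantumFields.YangMills.Theorems.PlainStabAdd

open MeasureTheory
open scoped BigOperators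
open Literature.MathematicalPhysics.QuantumFieldTheory.Balaban1983to89
open Literature.MathematicalPhysics.QuantumFieldTheory.Balaban1983to89.Missing
open Literature.MathematicalPhysics.QuantumFieldTheory.Balaban1983to89.T3ContinuumYM3Torus
open Literature.MathematicalPhysics.QuantumFieldTheory.Balaban1983to89.T3UnitScaleTilt
open Literature.MathematicalPhysics.QuantumFieldTheory.Balaban1983to89.T3UnitLawDensityEML (ℰp)
open Literature.MathematicalPhysics.QuantumFieldTheory.Balaban1983to89.T3LevelShift
open Summit.QuantumFields.YangMills.Theses.SmallFieldWidening

/-- The level-`n` block (column top) containing a finest-level site: `blockOf` iterated `n` times. [cite: Balaban1987RG1, (0.1) p.252] -/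
def colUp {P : Params} : (n : ℕ) → Site P 0 → Site P n
  | 0 => fun x => x
  | n + 1 => fun x => blockOf (colUp n x)

/-- The finest plaquettes of run `K` whose level-`K` column top lies within `ℓ¹` torus distance `r` of (the run-`K` copy of) the unit plaquette
`q`. [cite: Balaban1985UV3, (70)-(71) p.273] -/
def nearCol (F : T3Family) (K r : ℕ) (q : Plaq (F.P 0) 0) : Set (Plaq (F.P K) 0) :=
  {p' | Site.tdist (colUp K p'.src) (plaqShift (F.sitesPerDir_unit K) q).src ≤ r}

/-- STUB 1 (XL, the RG content) «LocalSmallStep»: base tail at a prover-chosen starting run with a rate floor `c_b` fixed before the precision,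
then the one-sided one-step comparison of the (threshold-multiplied) unit-plaquette tail RESTRICTED to the local small-field event of the new
finest level, with interval-summable slack `η·p(√γ)²` for every `η > 0` (the statement a prover must supply; Bałaban CMP 102 (70)–(71),
CMP 109 Thm 1, CMP 122 §1 are the nearest printed sources — this is a CRUX STUB of the route, not a published fact). -/
def LocalSmallStep : Prop :=
  ∀ (L : ℕ) (b₀ p₀ : ℝ), 0 < b₀ → 2 < p₀ → ∃ cb : ℝ, 0 < cb ∧ ∀ η : ℝ, 0 < η →
    ∃ (k₀ Nb r : ℕ) (γ₁ Cb A : ℝ), 1 ≤ k₀ ∧ 0 < γ₁ ∧ γ₁ ≤ 1 ∧ 0 ≤ Cb ∧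
      ∀ (F : T3Family) (γ : ℝ), F.L = L → 0 < γ → γ ≤ γ₁ → ∀ q : Plaq (F.P 0) 0, ∃ ρ t : ℕ → ℝ,
        (∀ K : ℕ, 1 / 2 ≤ t K ∧ t K ≤ 1) ∧
        (gibbsK F ℰp γ k₀).real {U | t k₀ * θBal F.L γ b₀ p₀ 0 ≤ GaugeGroup.dist1 (GaugeField.plaqHol
              (Averaging.iter (fun i => BlockAveraging.blockAvg (P := F.P k₀) (j := i) ℰp) k₀ U) (plaqShift (F.sitesPerDir_unit k₀) q))} ≤
          Cb * (γ⁻¹) ^ Nb * Real.exp (-(cb * B10.pFun b₀ p₀ (Real.sqrt γ) ^ 2)) ∧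
        (∀ k K : ℕ, k₀ ≤ k → ∑ j ∈ Finset.Ico k K, ρ j ≤ A + η * B10.pFun b₀ p₀ (Real.sqrt γ) ^ 2) ∧
        ∀ K : ℕ, k₀ ≤ K →
          (gibbsK F ℰp γ (K + 1)).real {U | PlaqSmallOn (nearCol F (K + 1) r q) (θBal F.L γ b₀ p₀ (K + 1)) U ∧
              t (K + 1) * θBal F.L γ b₀ p₀ 0 ≤ GaugeGroup.dist1 (GaugeField.plaqHol
              (Averaging.iter (fun i => BlockAveraging.blockAvg (P := F.P (K + 1)) (j := i) ℰp) (K + 1) U) (plaqShift (F.sitesPerDir_unit (K + 1)) q))} ≤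
          Real.exp (ρ K) *
          (gibbsK F ℰp γ K).real {U | t K * θBal F.L γ b₀ p₀ 0 ≤ GaugeGroup.dist1 (GaugeField.plaqHol
              (Averaging.iter (fun i => BlockAveraging.blockAvg (P := F.P K) (j := i) ℰp) K U) (plaqShift (F.sitesPerDir_unit K) q))}

/-- STUB 2 (M, real analysis over the tree's volume-uniform finest-level plaquette tail) «LocalNewLevelTail»: the Gibbs masses of the local
new-level LARGE-field events are summable along the ladder with a sub-Gaussian total, rate and power independent of the radius, uniformly in the
family (a CRUX STUB of the route, provable from the tree's finest-level plaquette tail; not a published fact). -/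
def LocalNewLevelTail : Prop :=
  ∀ (L : ℕ) (b₀ p₀ : ℝ), 0 < b₀ → 2 < p₀ → ∃ (γ₁ cτ : ℝ) (Nτ : ℕ), 0 < γ₁ ∧ γ₁ ≤ 1 ∧ 0 < cτ ∧
    ∀ r : ℕ, ∃ Cτ : ℝ, 0 ≤ Cτ ∧
      ∀ (F : T3Family) (γ : ℝ), F.L = L → 0 < γ → γ ≤ γ₁ → ∀ (q : Plaq (F.P 0) 0) (k₀ K : ℕ),
        ∑ k ∈ Finset.Ico k₀ K, (gibbsK F ℰp γ (k + 1)).real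
            {U | ¬ PlaqSmallOn (nearCol F (k + 1) r q) (θBal F.L γ b₀ p₀ (k + 1)) U} ≤
          Cτ * (γ⁻¹) ^ Nτ * Real.exp (-(cτ * B10.pFun b₀ p₀ (Real.sqrt γ) ^ 2))

end Summit.QuantumFields.YangMills.Theorems.PlainStabAdd

end
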